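import Summits.BirchSwinnertonDyer.BirchSwinnertonDyer.Theorems.ManinLocalTwoThreeThreeBlindUnitCubeIntrinsic
import HarnessLib

/-!
# The flex tangent at a `3`-torsion point: `α² = 3X₀`, so `3 ∣ α` — the `t³` blindness certificate is a single congruence

Summit `BirchSwinnertonDyer`, route `ManinLocalTwoThree` (cell bsd-f2-manin), crux C3 `ManinPrimeToThreeAtNine` (stmt-BirchSwinnertonDyer-22968),
stubs NB₃ / (BL).  For a point `T = (X₀, Y₀)` of order `3` on a short model `y² = x³ + a₄x + a₆` the tangent at `T` is the FLEX
tangent (`2T = −T` has abscissa `X₀`), i.e. `α² − 2X₀ = X₀`: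

* `y_ne_zero_of_isShortThreeTorsion` — `Y₀ ≠ 0` (a `3`-torsion point is not `2`-torsion; from non-singularity, no ellipticity needed);
* `tangentSlope_sq_eq_three_mul` — **`α² = 3·X₀`** (`(3X₀² + a₄)² − 12X₀Y₀² = −Ψ₃(X₀)`);
* `norm_tangentSlope_div_three_le_one` — hence at `3`: `X₀` `3`-integral ⟹ `α/3` is `3`-integral (`‖α‖² ≤ 3⁻¹` and the value group is `3^ℤ`);
  so the first clause of the lead's `t³` certificate `threeBlind_necessary` ALWAYS holds (census: `3 ∣ α` on 23 578 / 23 578 points —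
  now a theorem), and the certificate is the single congruence `Y₁ ≢ α/3 (mod 3)`: `not_threeBlind_of_residue_certificate[_of_nine_dvd]`;
* `threeBlind_iff_exists_isUnit_cube_map_of_isShortThreeTorsion[_of_nine_dvd]` — the unit-cube criterion (p641282/`…UnitCubeIntrinsic`)
  with the tangent-slope hypothesis discharged.

Nothing about BSD, Manin's conjecture or C3 is proved. [cite: SilvermanAEC2009, III.2.3 (duplication formula) and Ex. 3.7 (division polynomials)]
-/

set_option autoImplicit false
set_option linter.dupNamespace false

noncomputable section

open scoped Classical
open PowerSeries WeierstrassCurve Literature.NumberTheory.EllipticCurves Literature.NumberTheory.EllipticCurves.ModularForms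
open Summit.BirchSwinnertonDyer.Rank1Residual.ManinAdditive
open Summit.BirchSwinnertonDyer.Rank1Residual.ManinAdditive.CuspidalKummer
open Summit.BirchSwinnertonDyer.Rank1Residual.ManinAdditive.CuspidalKummerThree

namespace Summit.BirchSwinnertonDyer.BirchSwinnertonDyer.Theorems.ManinLocalTwoThree

/-! ### §1 The flex tangent -/

/-- The short-model equation at a point of `IsShortThreeTorsion`. [folklore] -/
theorem equation_of_isShortThreeTorsion {W : WeierstrassCurve ℚ} {c : ℤ} {X₀ Y₀ : ℚ} (hT : IsShortThreeTorsion W c X₀ Y₀) :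
    Y₀ ^ 2 = X₀ ^ 3 + (shortModel W c).a₄ * X₀ + (shortModel W c).a₆ := by
  have h := (Affine.equation_iff _ _).mp hT.1.1
  have h1 : (shortModel W c).a₁ = 0 := rfl
  have h2 : (shortModel W c).a₂ = 0 := rfl
  have h3 : (shortModel W c).a₃ = 0 := rfl
  simp only [h1, h2, h3, zero_mul, add_zero] at h
  linear_combination h

/-- **A `3`-torsion point is not `2`-torsion: `Y₀ ≠ 0`.**  If `Y₀ = 0` then `a₆ = −X₀³ − a₄X₀` and `Ψ₃(X₀) = −(3X₀² + a₄)²`, while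
non-singularity at `(X₀, 0)` says `3X₀² + a₄ ≠ 0`. [folklore] -/
theorem y_ne_zero_of_isShortThreeTorsion {W : WeierstrassCurve ℚ} {c : ℤ} {X₀ Y₀ : ℚ} (hT : IsShortThreeTorsion W c X₀ Y₀) :
    Y₀ ≠ 0 := by
  intro hY
  have heq := equation_of_isShortThreeTorsion hT
  have hΨ := (isRoot_Ψ₃_shortModel_iff W c X₀).mp hT.2
  have hns := ((Affine.nonsingular_iff _ _).mp hT.1).2
  have h1 : (shortModel W c).a₁ = 0 := rfl
  have h2 : (shortModel W c).a₂ = 0 := rfl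
  have h3 : (shortModel W c).a₃ = 0 := rfl
  subst hY
  have hsq : (3 * X₀ ^ 2 + (shortModel W c).a₄) ^ 2 = 0 := by linear_combination -hΨ - (12 * X₀) * heq
  have h0 : 3 * X₀ ^ 2 + (shortModel W c).a₄ = 0 := pow_eq_zero_iff two_ne_zero |>.mp hsq
  rcases hns with hx | hy
  · exact hx (by rw [h1, h2]; linear_combination -h0)
  · exact hy (by rw [h1, h3]; ring)

/-- **The flex identity `α² = 3X₀`** at a `3`-torsion point of a short model: the tangent at `T` meets the curve only at `T`
(`2T = −T`), so `x(2T) = α² − 2X₀ = X₀`; algebraically `(3X₀² + a₄)² − 12X₀Y₀² = −Ψ₃(X₀) = 0`.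
[cite: SilvermanAEC2009, III.2.3 (duplication formula)] -/
theorem tangentSlope_sq_eq_three_mul {W : WeierstrassCurve ℚ} {c : ℤ} {X₀ Y₀ : ℚ} (hT : IsShortThreeTorsion W c X₀ Y₀) :
    tangentSlope W c X₀ Y₀ ^ 2 = 3 * X₀ := by
  have heq := equation_of_isShortThreeTorsion hT
  have hΨ := (isRoot_Ψ₃_shortModel_iff W c X₀).mp hT.2
  have hY := y_ne_zero_of_isShortThreeTorsion hT
  rw [tangentSlope, div_pow, div_eq_iff (pow_ne_zero 2 (mul_ne_zero two_ne_zero hY))]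
  linear_combination -hΨ - (12 * X₀) * heq

/-! ### §2 At `3`: `3 ∣ α` -/

/-- **`X₀` `3`-integral ⟹ `α/3` `3`-integral**: `‖α‖² = ‖3X₀‖ ≤ 3⁻¹` and `‖α‖ ∈ 3^ℤ` force `‖α‖ ≤ 3⁻¹`. [folklore] -/
theorem norm_tangentSlope_div_three_le_one {W : WeierstrassCurve ℚ} {c : ℤ} {X₀ Y₀ : ℚ} (hT : IsShortThreeTorsion W c X₀ Y₀)
    (hX : ‖((X₀ : ℚ) : ℚ_[3])‖ ≤ 1) : ‖((tangentSlope W c X₀ Y₀ / 3 : ℚ) : ℚ_[3])‖ ≤ 1 := by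
  set α := tangentSlope W c X₀ Y₀ with hα
  have hsq : ‖((α : ℚ) : ℚ_[3])‖ ^ 2 ≤ 3⁻¹ := by
    have h3 : ‖(3 : ℚ_[3])‖ = 3⁻¹ := by
      have := Padic.norm_p (p := 3); exact_mod_cast this
    rw [← norm_pow, show ((α : ℚ) : ℚ_[3]) ^ 2 = ((α ^ 2 : ℚ) : ℚ_[3]) by push_cast; ring,
      tangentSlope_sq_eq_three_mul hT]
    push_cast
    rw [norm_mul, h3]
    exact mul_le_of_le_one_right (by norm_num) hX
  by_cases hα0 : ((α : ℚ) : ℚ_[3]) = 0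
  · have : ((α / 3 : ℚ) : ℚ_[3]) = 0 := by push_cast; rw [hα0, zero_div]
    rw [this, norm_zero]; exact zero_le_one
  -- `‖α‖ = 3^(−v)` with `v ≥ 1`
  have hn := Padic.norm_eq_zpow_neg_valuation hα0
  set v : ℤ := ((α : ℚ) : ℚ_[3]).valuation with hv
  have hv1 : 1 ≤ v := by
    by_contra hlt
    have hle : (0 : ℤ) ≤ -v := by omega
    have hge : (1 : ℝ) ≤ ‖((α : ℚ) : ℚ_[3])‖ := by
      rw [hn]; exact_mod_cast one_le_zpow₀ (by norm_num : (1 : ℝ) ≤ 3) hle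
    nlinarith [hsq, hge, norm_nonneg ((α : ℚ) : ℚ_[3])]
  have h3 : ‖(3 : ℚ_[3])‖ = (3 : ℝ) ^ (-1 : ℤ) := by
    have := Padic.norm_p (p := 3); rw [zpow_neg, zpow_one]; exact_mod_cast this
  have : ((α / 3 : ℚ) : ℚ_[3]) = ((α : ℚ) : ℚ_[3]) / 3 := by push_cast; ring
  rw [this, norm_div, hn, h3, div_le_one (by positivity)]
  push_cast
  exact zpow_le_zpow_right₀ (by norm_num) (by omega)

/-- `α` itself is `3`-integral. [folklore] -/
theorem norm_tangentSlope_le_one {W : WeierstrassCurve ℚ} {c : ℤ} {X₀ Y₀ : ℚ} (hT : IsShortThreeTorsion W c X₀ Y₀)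
    (hX : ‖((X₀ : ℚ) : ℚ_[3])‖ ≤ 1) : ‖((tangentSlope W c X₀ Y₀ : ℚ) : ℚ_[3])‖ ≤ 1 := by
  have h := norm_tangentSlope_div_three_le_one hT hX
  have h3 : ‖(3 : ℚ_[3])‖ ≤ 1 := by
    have := Padic.norm_p (p := 3)
    have e : ‖(3 : ℚ_[3])‖ = 3⁻¹ := by exact_mod_cast this
    rw [e]; norm_num
  have : ((tangentSlope W c X₀ Y₀ : ℚ) : ℚ_[3]) = 3 * ((tangentSlope W c X₀ Y₀ / 3 : ℚ) : ℚ_[3]) := by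
    push_cast; ring
  rw [this, norm_mul]
  calc ‖(3 : ℚ_[3])‖ * _ ≤ 1 * 1 := mul_le_mul h3 h (norm_nonneg _) zero_le_one
    _ = 1 := one_mul 1

/-! ### §3 The `t³` certificate is one congruence; the unit-cube criterion without the slope hypothesis -/

/-- **Non-blindness certificate, final form**: with `3`-integral `a₄♮, a₆♮, X₁, Y₁` and `T = (X₁, Y₁)` of order `3` on `E♮`, if
`Y₁ ≢ α/3 (mod 3)` then `T` is not `3`-blind (the clause `3 ∣ α` of `not_threeBlind_of_certificate` is automatic). [folklore] -/
theorem not_threeBlind_of_residue_certificate (W : WeierstrassCurve ℚ)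
    (hA : ‖(((shortModel W 1).a₄ : ℚ) : ℚ_[3])‖ ≤ 1) (hB : ‖(((shortModel W 1).a₆ : ℚ) : ℚ_[3])‖ ≤ 1)
    {X₁ Y₁ : ℚ} (hT : IsShortThreeTorsion W 1 X₁ Y₁) (hX : ‖((X₁ : ℚ) : ℚ_[3])‖ ≤ 1) (hY : ‖((Y₁ : ℚ) : ℚ_[3])‖ ≤ 1)
    (hcert : 1 < ‖(((Y₁ - tangentSlope W 1 X₁ Y₁ / 3) / 3 : ℚ) : ℚ_[3])‖) : ¬ ThreeBlind W X₁ Y₁ :=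
  not_threeBlind_of_certificate W hA hB hX hY (norm_tangentSlope_le_one hT hX) (Or.inr hcert)

/-- The same at a datum of level `9 ∣ N` (integrality of `E♮` automatic). [folklore] -/
theorem not_threeBlind_of_residue_certificate_of_nine_dvd (W : WeierstrassCurve ℚ) [W.IsElliptic] [W.IsGloballyMinimal]
    {N : ℕ} [NeZero N] (D : ModularParametrizationData W N) (h9 : 9 ∣ N)
    {X₁ Y₁ : ℚ} (hT : IsShortThreeTorsion W 1 X₁ Y₁) (hX : ‖((X₁ : ℚ) : ℚ_[3])‖ ≤ 1) (hY : ‖((Y₁ : ℚ) : ℚ_[3])‖ ≤ 1)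
    (hcert : 1 < ‖(((Y₁ - tangentSlope W 1 X₁ Y₁ / 3) / 3 : ℚ) : ℚ_[3])‖) : ¬ ThreeBlind W X₁ Y₁ :=
  not_threeBlind_of_certificate_of_nine_dvd W D h9 hX hY (norm_tangentSlope_le_one hT hX) (Or.inr hcert)

/-- **Unit-cube criterion for a `3`-torsion point** (slope hypothesis discharged): with `3`-integral `a₄♮, a₆♮, X₁, Y₁`,
`T` is `3`-blind iff `Θ♮_T` is the image of the cube of a unit of `ℤ₃⟦q⟧`. [cite: Washington1997, Thm. 7.3] -/
theorem threeBlind_iff_exists_isUnit_cube_map_of_isShortThreeTorsion (W : WeierstrassCurve ℚ)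
    (hA : ‖(((shortModel W 1).a₄ : ℚ) : ℚ_[3])‖ ≤ 1) (hB : ‖(((shortModel W 1).a₆ : ℚ) : ℚ_[3])‖ ≤ 1)
    {X₁ Y₁ : ℚ} (hT : IsShortThreeTorsion W 1 X₁ Y₁) (hX : ‖((X₁ : ℚ) : ℚ_[3])‖ ≤ 1) (hY : ‖((Y₁ : ℚ) : ℚ_[3])‖ ≤ 1) :
    ThreeBlind W X₁ Y₁ ↔ ∃ U : (ℤ_[3])⟦X⟧, IsUnit U ∧
      (U ^ 3).map (PadicInt.Coe.ringHom (p := 3)) = (kummerCubeSeries W 1 X₁ Y₁ X).map (Rat.castHom ℚ_[3]) :=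
  threeBlind_iff_exists_isUnit_cube_map W hA hB hX hY (norm_tangentSlope_le_one hT hX)

/-- The same at a datum of level `9 ∣ N`. [cite: Washington1997, Thm. 7.3] -/
theorem threeBlind_iff_exists_isUnit_cube_map_of_isShortThreeTorsion_of_nine_dvd (W : WeierstrassCurve ℚ) [W.IsElliptic]
    [W.IsGloballyMinimal] {N : ℕ} [NeZero N] (D : ModularParametrizationData W N) (h9 : 9 ∣ N)
    {X₁ Y₁ : ℚ} (hT : IsShortThreeTorsion W 1 X₁ Y₁) (hX : ‖((X₁ : ℚ) : ℚ_[3])‖ ≤ 1) (hY : ‖((Y₁ : ℚ) : ℚ_[3])‖ ≤ 1) :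
    ThreeBlind W X₁ Y₁ ↔ ∃ U : (ℤ_[3])⟦X⟧, IsUnit U ∧
      (U ^ 3).map (PadicInt.Coe.ringHom (p := 3)) = (kummerCubeSeries W 1 X₁ Y₁ X).map (Rat.castHom ℚ_[3]) :=
  threeBlind_iff_exists_isUnit_cube_map_of_nine_dvd W D h9 hX hY (norm_tangentSlope_le_one hT hX)

end Summit.BirchSwinnertonDyer.BirchSwinnertonDyer.Theorems.ManinLocalTwoThree

end
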